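import Mathlib
import Summits.Ventures.PercRepro2.Defs
import Summits.Ventures.PercRepro2.Independence
import Summits.Ventures.PercRepro2.Harris
import Summits.Ventures.PercRepro2.Graph
import Summits.Ventures.PercRepro2.Events
import Summits.Ventures.PercRepro2.Induced
import Summits.Ventures.PercRepro2.ObsIndependence
import Summits.Ventures.PercRepro2.BHK
import Summits.Ventures.PercRepro2.BHKEvents
import Summits.Ventures.PercRepro2.BHKAvoid
import Summits.Ventures.PercRepro2.BHKPair
import Summits.Ventures.PercRepro2.BHKAntitone
import Summits.Ventures.PercRepro2.BHKAntitoneCross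

/-!
# The (Z)-four-functions inequality for the pair `(C_s, C_t)` with two avoided-set patterns
(blind cell PercRepro2, mine-1 g51; paper proofs/MINE1-LSMPAIRS.md §9 — the lane's candidate
(Z4F) of paper MINE1-UNIONROW-K3.md §15.9 (ii))

For functionals `F, G : Set V → Set V → R` of the pair `(C_s, C_t)` that are (Z)-MONOTONE
(increasing in `C_s`, decreasing in `C_t`) and nonnegative, and vertex sets `X, Y ∋ t`:

  (a) `E[F(C_s,C_t) 1_{s↮X}] · E[G(C_s,C_t) 1_{s↮Y}] ≤ E[(FG)(C_s,C_t) 1_{s↮X∩Y}] · P(s↮X∪Y)`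
      (`zfour_s`: BHK06 Thm 1.5 (`bhk_pair`, the case `X = Y = {t}`) with two different avoided sets
      of `s` — the exploration of `C_s`, the tower identity with avoidance
      `expect_pair_mul_indicator_avoid`, Harris in the fibre `G ∖ C_s`, and `bhk_induced`);

  (b) for `X, Y ∋ s` and further sets `A, B` avoided by `s`:
      `E[F(C_s,C_t) 1_{s↮A} 1_{t↮X}] · E[G(C_s,C_t) 1_{s↮B} 1_{t↮Y}]
         ≤ P(s↮A∪B, t↮X∩Y) · E[(FG)(C_s,C_t) 1_{t↮X∪Y}]`
      (`zfour_t`: the exploration of `C_t`; the (Z)-monotone functional becomes a DECREASING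
      functional of `C_t` and the avoidance of `A` an INCREASING one, so the antitone theorem
      `bhk_antitone_induced` (`BHKAntitone.lean`) is what closes it, with Harris in the fibre).

With `F = 1_{S₁} · 1_{C_t ∩ Y₁ = ∅}` etc. these are the two admissible shapes of the status-grid
inequality (Z4F): `M(S₁ ∩ R′_{X₁} ∩ R_{Y₁}) M(S₂ ∩ R′_{X₂} ∩ R_{Y₂}) ≤
M(S₁∩S₂ ∩ R′_{X₁∩X₂} ∩ R_{Y₁∪Y₂}) M(R′_{X₁∪X₂} ∩ R_{Y₁∩Y₂})` for (Z)-up-sets `S₁, S₂`, proved here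
when `Y₁ ∩ Y₂ = ∅` (by (a)) and when `X₁ ∩ X₂ = ∅` (by (b)); in the remaining shape (both
intersections nonempty) it is false (paper §15.2 / §15.9).
-/

namespace Summit.Ventures.PercRepro2

namespace ZFour

section Tower

variable {V : Type*} {E : Type*} [Fintype E] [DecidableEq E] [Fintype V] [DecidableEq V]
  {R : Type*} [CommRing R]

omit [DecidableEq V] in
/-- **The tower identity with avoidance**: for `t ∈ X`,
`E[F(C_s, C_t) 1_{s↮X}] = E[F̂(C_s) 1_{s↮X}]` with `F̂(W) = E[F(W, C_t) in G ∖ W]` — exploring the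
cluster of `s`, on `{s ↮ X}` the cluster of `t` is its cluster in `G ∖ C_s`. -/
theorem expect_pair_mul_indicator_avoid (p : E → R) (ends : E → Sym2 V) (s t : V)
    {X : Finset V} (ht : t ∈ X) (F : Set V → Set V → R) :
    expect p (fun ω => F (cluster ends ω s) (cluster ends ω t) *
        (avoidAll ends s X).indicator 1 ω) =
      expect p (fun ω => expect p (fun ω' => F (cluster ends ω s)
        (cluster ends (delConfig ends (cluster ends ω s) ω') t)) *
        (avoidAll ends s X).indicator 1 ω) := by
  classical
  let 𝓐 : Set (Set V) := {W | ∀ x ∈ X, x ∉ W}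
  have hA : ∀ ω, ω ∈ avoidAll ends s X ↔ cluster ends ω s ∈ 𝓐 := fun ω => Iff.rfl
  let c : Set V → R := fun W => 𝓐.indicator 1 W
  let D : Set V → Config E → R := fun W ω => F W (cluster ends (delConfig ends W ω) t)
  let Φ : Set V → Config E → R := fun W ω => c W * D W ω
  have hΦ : ∀ W, DependsOn (Φ W) (touches ends W)ᶜ := by
    intro W ω ω' h
    simp only [Φ, D]
    rw [delConfig_congr h]
  have hS : ∀ W : Set V, DependsOn (· ∈ {ω | cluster ends ω s = W}) (touches ends W) :=
    fun W => dependsOn_clusterEvent ends s W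
  have hdisj : ∀ W : Set V, Disjoint (touches ends W) (touches ends W)ᶜ :=
    fun W => disjoint_compl_right
  have hpt : ∀ ω, F (cluster ends ω s) (cluster ends ω t) *
      (avoidAll ends s X).indicator (1 : Config E → R) ω = Φ (cluster ends ω s) ω := by
    intro ω
    simp only [Φ, c, D]
    by_cases hav : ω ∈ avoidAll ends s X
    · have hst : t ∉ cluster ends ω s := notMem_cluster_of_mem_avoidAll ht hav
      rw [Set.indicator_of_mem hav, Set.indicator_of_mem ((hA ω).1 hav),
        cluster_delConfig_cluster hst]
      simp
    · rw [Set.indicator_of_notMem hav, Set.indicator_of_notMem (fun h => hav ((hA ω).2 h))]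
      simp
  have hΦexp : ∀ W, expect p (Φ W) =
      c W * expect p (fun ω' => F W (cluster ends (delConfig ends W ω') t)) := by
    intro W
    simp only [Φ, D]
    rw [expect_const_mul]
  have e1 : (fun ω => F (cluster ends ω s) (cluster ends ω t) *
      (avoidAll ends s X).indicator (1 : Config E → R) ω) = fun ω => Φ (cluster ends ω s) ω :=
    funext hpt
  rw [e1, expect_tower p hdisj (S := fun ω => cluster ends ω s) hS hΦ]
  simp only [hΦexp]
  unfold expect
  refine Finset.sum_congr rfl fun ω _ => ?_
  simp only [c]
  by_cases hav : ω ∈ avoidAll ends s X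
  · rw [Set.indicator_of_mem ((hA ω).1 hav), Set.indicator_of_mem hav]
    simp
  · rw [Set.indicator_of_notMem (fun h => hav ((hA ω).2 h)), Set.indicator_of_notMem hav]
    simp

end Tower

section ZFourS

variable {V : Type*} {E : Type*} [Fintype E] [DecidableEq E] [Fintype V] [DecidableEq V]
  {R : Type*} [CommRing R] [LinearOrder R] [IsStrictOrderedRing R]

/-- **(Z)-four functions, two avoided sets of `s`** (BHK06 Thm 1.5 with `X ≠ Y`): for nonnegative
(Z)-monotone functionals `F, G` of `(C_s, C_t)` and `X, Y ∋ t`,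
`E[F(C_s,C_t) 1_{s↮X}] · E[G(C_s,C_t) 1_{s↮Y}] ≤ E[(FG)(C_s,C_t) 1_{s↮X∩Y}] · P(s↮X∪Y)`. -/
theorem zfour_s (p : E → R) (hp : IsProbVec p) (ends : E → Sym2 V) (s t : V) {X Y : Finset V}
    (htX : t ∈ X) (htY : t ∈ Y) {F G : Set V → Set V → R}
    (hF : ∀ ⦃W W' C C' : Set V⦄, W ⊆ W' → C' ⊆ C → F W C ≤ F W' C')
    (hG : ∀ ⦃W W' C C' : Set V⦄, W ⊆ W' → C' ⊆ C → G W C ≤ G W' C')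
    (hF0 : ∀ W C, 0 ≤ F W C) (hG0 : ∀ W C, 0 ≤ G W C) :
    expect p (fun ω => F (cluster ends ω s) (cluster ends ω t) *
        (avoidAll ends s X).indicator 1 ω) *
      expect p (fun ω => G (cluster ends ω s) (cluster ends ω t) *
        (avoidAll ends s Y).indicator 1 ω) ≤
    expect p (fun ω => F (cluster ends ω s) (cluster ends ω t) *
        G (cluster ends ω s) (cluster ends ω t) * (avoidAll ends s (X ∩ Y)).indicator 1 ω) *
      prob p (avoidAll ends s (X ∪ Y)) := by
  classical
  have htXY : t ∈ X ∩ Y := Finset.mem_inter.2 ⟨htX, htY⟩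
  set Fh : Set V → R := fun W => expect p (fun ω => F W (cluster ends (delConfig ends W ω) t))
    with hFh
  set Gh : Set V → R := fun W => expect p (fun ω => G W (cluster ends (delConfig ends W ω) t))
    with hGh
  have hFm : Monotone Fh := BHKPair.delPairExpect_mono p hp ends t hF
  have hGm : Monotone Gh := BHKPair.delPairExpect_mono p hp ends t hG
  have hF0' : ∀ W, 0 ≤ Fh W := BHKPair.delPairExpect_nonneg p hp ends t hF0
  have hG0' : ∀ W, 0 ≤ Gh W := BHKPair.delPairExpect_nonneg p hp ends t hG0
  have key := bhk_induced p hp ends s hFm hGm hF0' hG0' Finset.univ X Y (Finset.subset_univ _)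
    (Finset.subset_univ _)
  simp only [REvent_univ] at key
  have e : ∀ (H : Set V → R) (A : Set (Config E)),
      clusterObs ends Finset.univ s H * A.indicator 1 =
        fun ω => H (cluster ends ω s) * A.indicator 1 ω := by
    intro H A
    funext ω
    simp only [Pi.mul_apply, clusterObs_apply, clusterIn_univ]
  rw [e, e, e] at key
  simp only [Pi.mul_apply] at key
  rw [expect_pair_mul_indicator_avoid p ends s t htX F,
    expect_pair_mul_indicator_avoid p ends s t htY G,
    expect_pair_mul_indicator_avoid p ends s t htXY (fun W C => F W C * G W C)]
  -- Harris in `G ∖ W` pointwise, then monotonicity of the expectation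
  have hpt : ∀ ω, Fh (cluster ends ω s) * Gh (cluster ends ω s) *
      (avoidAll ends s (X ∩ Y)).indicator (1 : Config E → R) ω ≤
      expect p (fun ω' => F (cluster ends ω s)
        (cluster ends (delConfig ends (cluster ends ω s) ω') t) *
        G (cluster ends ω s) (cluster ends (delConfig ends (cluster ends ω s) ω') t)) *
        (avoidAll ends s (X ∩ Y)).indicator 1 ω := by
    intro ω
    exact mul_le_mul_of_nonneg_right (BHKPair.delPairExpect_mul_le p hp ends t hF hG _)
      (Set.indicator_apply_nonneg fun _ => zero_le_one)
  have hmono := expect_mono hp hpt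
  have hQ0 : 0 ≤ prob p (avoidAll ends s (X ∪ Y)) := prob_nonneg hp _
  exact key.trans (mul_le_mul_of_nonneg_right hmono hQ0)

end ZFourS

section ZFourT

variable {V : Type*} {E : Type*} [Fintype E] [DecidableEq E] [Fintype V] [DecidableEq V]
  {R : Type*} [CommRing R] [LinearOrder R] [IsStrictOrderedRing R]

omit [Fintype E] [DecidableEq E] [Fintype V] [DecidableEq V] [LinearOrder R]
  [IsStrictOrderedRing R] in
/-- The indicator of `{s ↮ A}` is the indicator of the family `{K | K ∩ A = ∅}` at `C_s`. -/
lemma indicator_avoidAll_eq (ends : E → Sym2 V) (s : V) (A : Finset V) (ω : Config E) :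
    (avoidAll ends s A).indicator (1 : Config E → R) ω =
      ({K : Set V | ∀ x ∈ A, x ∉ K}).indicator (1 : Set V → R) (cluster ends ω s) := by
  have hA : ω ∈ avoidAll ends s A ↔ cluster ends ω s ∈ {K : Set V | ∀ x ∈ A, x ∉ K} := Iff.rfl
  by_cases h : ω ∈ avoidAll ends s A
  · rw [Set.indicator_of_mem h, Set.indicator_of_mem (hA.1 h)]
    rfl
  · rw [Set.indicator_of_notMem h, Set.indicator_of_notMem (fun h' => h (hA.2 h'))]

omit [Fintype E] [DecidableEq E] [Fintype V] [DecidableEq V] in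
/-- `{K | K ∩ A = ∅}` is a down-set. -/
lemma isLowerSet_avoidFamily (A : Finset V) : IsLowerSet {K : Set V | ∀ x ∈ A, x ∉ K} :=
  fun _ _ h hK x hx hxK => hK x hx (h hxK)

omit [Fintype V] [DecidableEq V] [LinearOrder R] [IsStrictOrderedRing R] in
/-- `δ_𝓐(L) = P(C_s ∈ 𝓐 in G ∖ L)` as an expectation of the indicator. -/
lemma delClusterProb_eq_expect_indicator (p : E → R) (ends : E → Sym2 V) (s : V)
    (𝓐 : Set (Set V)) (L : Set V) :
    delClusterProb p ends s 𝓐 L =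
      expect p (fun ω' => 𝓐.indicator (1 : Set V → R) (cluster ends (delConfig ends L ω') s)) := by
  unfold delClusterProb
  rw [prob_eq_expect_indicator]
  congr 1

omit [Fintype E] [DecidableEq E] [Fintype V] [DecidableEq V] [CommRing R]
  [IsStrictOrderedRing R] in
/-- For a (Z)-monotone `F`, `ω' ↦ F(C_s(G ∖ L, ω'), L)` is a monotone observable. -/
lemma monotone_pairObs (ends : E → Sym2 V) (s : V) {F : Set V → Set V → R}
    (hF : ∀ ⦃W W' C C' : Set V⦄, W ⊆ W' → C' ⊆ C → F W C ≤ F W' C') (L : Set V) :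
    Monotone (fun ω' : Config E => F (cluster ends (delConfig ends L ω') s) L) := by
  intro ω ω' h
  exact hF (cluster_mono (BHKPair.delConfig_mono_config ends L h) s) (subset_refl L)

omit [Fintype V] [DecidableEq V] in
/-- For a (Z)-monotone `F`, `D_F(L) = E[F(C_s, L) in G ∖ L]` is antitone in `L`. -/
lemma antitone_delPairExpect_t (p : E → R) (hp : IsProbVec p) (ends : E → Sym2 V) (s : V)
    {F : Set V → Set V → R} (hF : ∀ ⦃W W' C C' : Set V⦄, W ⊆ W' → C' ⊆ C → F W C ≤ F W' C') :
    Antitone (fun L => expect p (fun ω' => F (cluster ends (delConfig ends L ω') s) L)) := by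
  intro L L' h
  exact expect_mono hp fun ω' => hF (cluster_mono (delConfig_anti h ω') s) h

/-- **(Z)-four functions, two avoided sets of `t`** (the mirror of `zfour_s`, proved through the
ANTITONE theorem): for nonnegative (Z)-monotone functionals `F, G` of `(C_s, C_t)`, sets `A, B`
avoided by `s` and `X, Y ∋ s` avoided by `t`,
`E[F(C_s,C_t) 1_{s↮A} 1_{t↮X}] · E[G(C_s,C_t) 1_{s↮B} 1_{t↮Y}]
  ≤ P(s↮A∪B, t↮X∩Y) · E[(FG)(C_s,C_t) 1_{t↮X∪Y}]`. -/
theorem zfour_t (p : E → R) (hp : IsProbVec p) (ends : E → Sym2 V) (s t : V) {X Y : Finset V}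
    (hsX : s ∈ X) (hsY : s ∈ Y) (A B : Finset V) {F G : Set V → Set V → R}
    (hF : ∀ ⦃W W' C C' : Set V⦄, W ⊆ W' → C' ⊆ C → F W C ≤ F W' C')
    (hG : ∀ ⦃W W' C C' : Set V⦄, W ⊆ W' → C' ⊆ C → G W C ≤ G W' C')
    (hF0 : ∀ W C, 0 ≤ F W C) (hG0 : ∀ W C, 0 ≤ G W C) :
    expect p (fun ω => F (cluster ends ω s) (cluster ends ω t) *
        (avoidAll ends s A).indicator 1 ω * (avoidAll ends t X).indicator 1 ω) *
      expect p (fun ω => G (cluster ends ω s) (cluster ends ω t) *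
        (avoidAll ends s B).indicator 1 ω * (avoidAll ends t Y).indicator 1 ω) ≤
    prob p (avoidAll ends s (A ∪ B) ∩ avoidAll ends t (X ∩ Y)) *
      expect p (fun ω => F (cluster ends ω s) (cluster ends ω t) *
        G (cluster ends ω s) (cluster ends ω t) * (avoidAll ends t (X ∪ Y)).indicator 1 ω) := by
  classical
  have hsXY : s ∈ X ∩ Y := Finset.mem_inter.2 ⟨hsX, hsY⟩
  have hsXY' : s ∈ X ∪ Y := Finset.mem_union_left Y hsX
  set 𝓐 : Set (Set V) := {K | ∀ x ∈ A, x ∉ K} with h𝓐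
  set 𝓑 : Set (Set V) := {K | ∀ x ∈ B, x ∉ K} with h𝓑
  -- the functionals of the explored cluster `L = C_t`
  set DF : Set V → R := fun L => expect p (fun ω' => F (cluster ends (delConfig ends L ω') s) L)
    with hDF
  set DG : Set V → R := fun L => expect p (fun ω' => G (cluster ends (delConfig ends L ω') s) L)
    with hDG
  set FA : Set V → R := delClusterProb p ends s 𝓐 with hFA
  set FB : Set V → R := delClusterProb p ends s 𝓑 with hFB
  have aDF : Antitone DF := antitone_delPairExpect_t p hp ends s hF
  have aDG : Antitone DG := antitone_delPairExpect_t p hp ends s hG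
  have mFA : Monotone FA :=
    BHKAntitoneCross.delClusterProb_mono_of_isLowerSet p hp ends s (isLowerSet_avoidFamily A)
  have mFB : Monotone FB :=
    BHKAntitoneCross.delClusterProb_mono_of_isLowerSet p hp ends s (isLowerSet_avoidFamily B)
  have nDF : ∀ L, 0 ≤ DF L := fun L => expect_nonneg hp fun _ => hF0 _ _
  have nDG : ∀ L, 0 ≤ DG L := fun L => expect_nonneg hp fun _ => hG0 _ _
  have nFA : ∀ L, 0 ≤ FA L := delClusterProb_nonneg p hp ends s 𝓐
  have nFB : ∀ L, 0 ≤ FB L := delClusterProb_nonneg p hp ends s 𝓑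
  have nI : ∀ (S : Set (Config E)) (ω : Config E), 0 ≤ S.indicator (1 : Config E → R) ω :=
    fun S ω => Set.indicator_apply_nonneg fun _ => zero_le_one
  -- the antitone BHK inequality for the root `t`
  have key := bhk_antitone_induced p hp ends t mFA mFB aDF aDG nFA nFB nDF nDG Finset.univ X Y
    (Finset.subset_univ _) (Finset.subset_univ _)
  simp only [REvent_univ] at key
  have e : ∀ (H : Set V → R) (S : Set (Config E)),
      clusterObs ends Finset.univ t H * S.indicator 1 =
        fun ω => H (cluster ends ω t) * S.indicator 1 ω := by
    intro H S
    funext ω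
    simp only [Pi.mul_apply, clusterObs_apply, clusterIn_univ]
  rw [e, e, e, e] at key
  simp only [Pi.mul_apply] at key
  -- the left factors: tower identity for the root `t`, then Harris in the fibre `G ∖ L`
  have eL : ∀ (H : Set V → Set V → R) (C : Finset V) {Z : Finset V} (hsZ : s ∈ Z),
      (∀ ⦃W W' C C' : Set V⦄, W ⊆ W' → C' ⊆ C → H W C ≤ H W' C') →
      expect p (fun ω => H (cluster ends ω s) (cluster ends ω t) *
        (avoidAll ends s C).indicator 1 ω * (avoidAll ends t Z).indicator 1 ω) ≤
      expect p (fun ω => delClusterProb p ends s {K | ∀ x ∈ C, x ∉ K} (cluster ends ω t) *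
        expect p (fun ω' => H (cluster ends (delConfig ends (cluster ends ω t) ω') s)
          (cluster ends ω t)) * (avoidAll ends t Z).indicator 1 ω) := by
    intro H C Z hsZ hH
    have htow : expect p (fun ω => H (cluster ends ω s) (cluster ends ω t) *
        ({K' : Set V | ∀ x ∈ C, x ∉ K'}).indicator (1 : Set V → R) (cluster ends ω s) *
        (avoidAll ends t Z).indicator 1 ω) =
        expect p (fun ω => expect p (fun ω' =>
          H (cluster ends (delConfig ends (cluster ends ω t) ω') s) (cluster ends ω t) *
          ({K' : Set V | ∀ x ∈ C, x ∉ K'}).indicator (1 : Set V → R)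
            (cluster ends (delConfig ends (cluster ends ω t) ω') s)) *
          (avoidAll ends t Z).indicator 1 ω) :=
      expect_pair_mul_indicator_avoid p ends t s hsZ
        (fun L K => H K L * ({K' : Set V | ∀ x ∈ C, x ∉ K'}).indicator 1 K)
    have e1 : (fun ω => H (cluster ends ω s) (cluster ends ω t) *
        (avoidAll ends s C).indicator (1 : Config E → R) ω * (avoidAll ends t Z).indicator 1 ω) =
        fun ω => H (cluster ends ω s) (cluster ends ω t) *
          ({K' : Set V | ∀ x ∈ C, x ∉ K'}).indicator (1 : Set V → R) (cluster ends ω s) *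
          (avoidAll ends t Z).indicator 1 ω := by
      funext ω
      rw [indicator_avoidAll_eq]
    rw [e1, htow]
    refine expect_mono hp fun ω => ?_
    refine mul_le_mul_of_nonneg_right ?_ (nI _ ω)
    -- Harris: monotone × antitone
    have hmono := monotone_pairObs ends s hH (cluster ends ω t)
    have hanti : Antitone (fun ω' : Config E => ({K' : Set V | ∀ x ∈ C, x ∉ K'}).indicator
        (1 : Set V → R) (cluster ends (delConfig ends (cluster ends ω t) ω') s)) := by
      intro ω₁ ω₂ h
      dsimp only
      have hsub := cluster_mono (ends := ends)
        (BHKPair.delConfig_mono_config ends (cluster ends ω t) h) s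
      by_cases h2 : cluster ends (delConfig ends (cluster ends ω t) ω₂) s ∈
          {K' : Set V | ∀ x ∈ C, x ∉ K'}
      · rw [Set.indicator_of_mem h2, Set.indicator_of_mem (isLowerSet_avoidFamily C hsub h2)]
        simp
      · rw [Set.indicator_of_notMem h2]
        exact Set.indicator_apply_nonneg fun _ => zero_le_one
    have h := expect_mul_le_expect_mul_expect_of_antitone hp hmono hanti
    rw [delClusterProb_eq_expect_indicator, mul_comm]
    exact h
  have eL₁ := eL F A hsX hF
  have eL₂ := eL G B hsY hG
  -- the join factor: Harris for the two down-set families in the fibre, then the identity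
  have eJ : expect p (fun ω => FA (cluster ends ω t) * FB (cluster ends ω t) *
      (avoidAll ends t (X ∩ Y)).indicator 1 ω) ≤
      prob p (avoidAll ends s (A ∪ B) ∩ avoidAll ends t (X ∩ Y)) := by
    have hid := prob_clusterIn_inter_avoid_eq_expect p ends t s hsXY Set.univ (𝓐 ∩ 𝓑)
    simp only [Set.indicator_univ, Pi.one_apply, one_mul] at hid
    have eset : clusterInEvent ends t Set.univ ∩ clusterInEvent ends s (𝓐 ∩ 𝓑) ∩
        avoidAll ends t (X ∩ Y) = avoidAll ends s (A ∪ B) ∩ avoidAll ends t (X ∩ Y) := by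
      ext ω
      simp only [clusterInEvent, Set.mem_inter_iff, Set.mem_setOf_eq, Set.mem_univ, true_and,
        h𝓐, h𝓑, avoidAll, Finset.mem_union]
      constructor
      · rintro ⟨⟨hA', hB'⟩, hZ⟩
        refine ⟨fun x hx => ?_, hZ⟩
        rcases hx with hx | hx
        · exact hA' x hx
        · exact hB' x hx
      · rintro ⟨hAB, hZ⟩
        exact ⟨⟨fun x hx => hAB x (Or.inl hx), fun x hx => hAB x (Or.inr hx)⟩, hZ⟩
    rw [eset] at hid
    rw [hid]
    refine expect_mono hp fun ω => ?_
    refine mul_le_mul_of_nonneg_right ?_ (nI _ ω)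
    exact BHKAntitoneCross.delClusterProb_mul_le_inter_of_isLowerSet p hp ends s
      (isLowerSet_avoidFamily A) (isLowerSet_avoidFamily B) _
  -- the meet factor: Harris for the two monotone observables in the fibre, then the identity
  have eM : expect p (fun ω => DF (cluster ends ω t) * DG (cluster ends ω t) *
      (avoidAll ends t (X ∪ Y)).indicator 1 ω) ≤
      expect p (fun ω => F (cluster ends ω s) (cluster ends ω t) *
        G (cluster ends ω s) (cluster ends ω t) * (avoidAll ends t (X ∪ Y)).indicator 1 ω) := by
    have htow : expect p (fun ω => F (cluster ends ω s) (cluster ends ω t) *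
        G (cluster ends ω s) (cluster ends ω t) *
        (avoidAll ends t (X ∪ Y)).indicator (1 : Config E → R) ω) =
        expect p (fun ω => expect p (fun ω' =>
          F (cluster ends (delConfig ends (cluster ends ω t) ω') s) (cluster ends ω t) *
          G (cluster ends (delConfig ends (cluster ends ω t) ω') s) (cluster ends ω t)) *
          (avoidAll ends t (X ∪ Y)).indicator 1 ω) :=
      expect_pair_mul_indicator_avoid p ends t s hsXY' (fun L K => F K L * G K L)
    rw [htow]
    refine expect_mono hp fun ω => ?_
    refine mul_le_mul_of_nonneg_right ?_ (nI _ ω)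
    have h := expect_mul_expect_le_expect_mul hp (monotone_pairObs ends s hF (cluster ends ω t))
      (monotone_pairObs ends s hG (cluster ends ω t))
    exact h
  have nL₂ : 0 ≤ expect p (fun ω => G (cluster ends ω s) (cluster ends ω t) *
      (avoidAll ends s B).indicator 1 ω * (avoidAll ends t Y).indicator 1 ω) :=
    expect_nonneg hp fun ω => mul_nonneg (mul_nonneg (hG0 _ _) (nI _ ω)) (nI _ ω)
  have nR₁ : 0 ≤ expect p (fun ω => FA (cluster ends ω t) * DF (cluster ends ω t) *
      (avoidAll ends t X).indicator 1 ω) :=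
    expect_nonneg hp fun ω => mul_nonneg (mul_nonneg (nFA _) (nDF _)) (nI _ ω)
  have nM : 0 ≤ expect p (fun ω => DF (cluster ends ω t) * DG (cluster ends ω t) *
      (avoidAll ends t (X ∪ Y)).indicator 1 ω) :=
    expect_nonneg hp fun ω => mul_nonneg (mul_nonneg (nDF _) (nDG _)) (nI _ ω)
  have nJ : 0 ≤ prob p (avoidAll ends s (A ∪ B) ∩ avoidAll ends t (X ∩ Y)) := prob_nonneg hp _
  calc expect p (fun ω => F (cluster ends ω s) (cluster ends ω t) *
          (avoidAll ends s A).indicator 1 ω * (avoidAll ends t X).indicator 1 ω) *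
        expect p (fun ω => G (cluster ends ω s) (cluster ends ω t) *
          (avoidAll ends s B).indicator 1 ω * (avoidAll ends t Y).indicator 1 ω)
      ≤ expect p (fun ω => FA (cluster ends ω t) * DF (cluster ends ω t) *
          (avoidAll ends t X).indicator 1 ω) *
        expect p (fun ω => FB (cluster ends ω t) * DG (cluster ends ω t) *
          (avoidAll ends t Y).indicator 1 ω) := mul_le_mul eL₁ eL₂ nL₂ nR₁
    _ ≤ expect p (fun ω => FA (cluster ends ω t) * FB (cluster ends ω t) *
          (avoidAll ends t (X ∩ Y)).indicator 1 ω) *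
        expect p (fun ω => DF (cluster ends ω t) * DG (cluster ends ω t) *
          (avoidAll ends t (X ∪ Y)).indicator 1 ω) := key
    _ ≤ prob p (avoidAll ends s (A ∪ B) ∩ avoidAll ends t (X ∩ Y)) *
        expect p (fun ω => F (cluster ends ω s) (cluster ends ω t) *
          G (cluster ends ω s) (cluster ends ω t) * (avoidAll ends t (X ∪ Y)).indicator 1 ω) :=
        mul_le_mul eJ eM nM nJ

end ZFourT

end ZFour

end Summit.Ventures.PercRepro2
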